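import Literature.Analysis.FluidPDE.NSCriticalClosureBesovPathSpace
import Literature.Analysis.FluidPDE.NSClassicalKatoWeights
import Literature.Analysis.FluidPDE.AlbrittonBlowupCriterionKato
import Literature.Analysis.FluidPDE.TaoQuantitativeAgmon
import Literature.Analysis.FluidPDE.SmoothL2FieldCalculus
import Literature.Analysis.FluidPDE.NSLerayHopfSereginAssembly
import HarnessLib

/-!
# The critical Besov continuation criterion: Albritton's class, singular points at the blow-up
# time, and the reduction to the regularity of the points `(T, x₀)`

Analysis/FluidPDE assembly file (proofs only: no definition, no named fact, no statement of the
tree is changed) for the named fact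
`Literature.Analysis.FluidPDE.hasSmoothExtensionPast_of_eHomBesovNorm_bounded`
(`NSCriticalClosure.lean`; Gallagher–Koch–Planchon 2016, Thm. 1, contrapositive for classical
Leray–Hopf solutions from rapidly decaying data: a classical Leray–Hopf solution on `[0, T)` whose
critical Besov norm `‖u(t)‖_{Ḃ^{-1+3/r}_{r,q}}`, `3 < r, q < ∞`, stays bounded extends smoothly
past `T`).

## 1. Albritton's Theorem 1.1 over Albritton's class

The faithful statement of D. Albritton, *Blow-up criteria for the Navier–Stokes equations in
non-endpoint critical Besov spaces*, Anal. PDE 11 (2018) 1415–1456 = arXiv:1612.04439, **Thm. 1.1**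
("Let `3 < p, q < ∞` and `u₀ ∈ Ḃ^{s_p}_{p,q}` be a divergence-free vector field. Suppose `u` is the
mild solution … with initial data `u₀` and maximal time of existence `T*(u₀)`. If `T* < ∞`, then
`lim_{t ↑ T*} ‖u(t)‖_{Ḃ^{s_p}_{p,q}} = ∞`", p. 4) is read in the tree over **Albritton's own
uniqueness class** (4.52) of his Thm. 4.2 — `u ∈ K̊_p(Q_T) ∩ K̊_∞(Q_T) ∩ C((0,T]; L^p ∩ L^∞)` —
rendered by `IsMaximalKatoBesovMildSolution p q T ν u U` (`AlbrittonBlowupCriterionKato.lean`, which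
records the discrepancy with the deprecated tree-class rendering `albritton_besov_blowup` and
displays the corrected named fact `albritton_besov_blowup_katoClass`, left undeclared there under
D-0026). This file proves that **that corrected statement implies the continuation criterion**,
every other input being a theorem of the tree:

* `hasSmoothExtensionPast_of_eHomBesovNorm_bounded_of_albritton_besov_blowup_katoClass (hA) : _` —
  `hA` is *verbatim* the displayed text of `albritton_besov_blowup_katoClass`;
* the weaker `sup`/`limsup` forms `…_of_katoClass_sup`, `…_of_katoClass_limsup`.

(The GKP-path-space and GKP-class renderings are served by the sibling files
`NSCriticalClosureBesovGKPClass.lean` / `NSCriticalClosureBesovGKPClassProps.lean`.) The reduction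
is that of `NSCriticalClosureBesovPathSpace.lean`: a classical Leray–Hopf solution `u` on `[0, T)`
from a rapidly decaying datum that does **not** extend smoothly past `T` is a *maximal* member of
Albritton's class with lifespan `T` (an extension in the class lies in the tree's class, is
essentially bounded near `T` by its `K̊_∞` clause, and then `u` extends by the KNSS smoothing of
bounded mild solutions, `hasSmoothExtensionPast_of_isBesovMildSolutionOn_extension_of_bounded`
with `knss2009_local_smoothing_holds`). The new input is the **membership**
`isKatoBesovMildSolutionOn_of_classical`: besides the tree's-class membership
(`isBesovMildSolutionOn_of_classical`, Tao 2013) and the `K̊_p` clause (`katoWeight_of_classical`,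
`NSClassicalKatoWeights.lean`), Albritton's class asks `u ∈ C((0,T); L^p)` and
`u ∈ C((0,T); L^∞)`. Both are proved on every closed slab `[0, T₁]`, `T₁ < T`, from the `L²`
continuity of `u` (`continuousInLpOn_two_of_tao_local`) and the uniform Sobolev bounds of Tao
2013, Cor. 11.1 (`tao2011_hasBoundedSobolevNormsOn_holds`):

* in `L^p`, `2 ≤ p < ∞`, by `‖w‖_{L^p} ≤ (M^{p-2} ‖w‖²_{L²})^{1/p}` for `w = u(t) - u(t₀)`,
  `|w| ≤ M` (`continuousInLpOn_slab_of_classical`);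
* in `L^∞` by **Agmon's inequality** `‖w‖_∞ ≤ K (∫|∇w|² ∫|Δw|²)^{1/4}` (Robinson–Rodrigo–Sadowski
  2016, Thm. 1.20; the tree's `IsSmoothL2Field.norm_le_agmon_laplacian`) combined with Green's
  identity `∫|∇w|² = -∫⟪w, Δw⟫ ≤ ‖w‖_{L²} ‖Δw‖_{L²}`, i.e. the interpolation
  `‖w‖_∞ ≤ K ‖w‖^{1/4}_{L²} ‖Δw‖^{3/4}_{L²}` (`IsSmoothL2Field.norm_le_agmon_interpolate`), with
  `‖Δw‖_{L²} ≤ 3 (‖D²u(t)‖_{L²} + ‖D²u(t₀)‖_{L²})` bounded on the slab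
  (`continuousInLpOn_top_slab_of_classical`). This is the statement `∇ᵐu ∈ C((0,T); L² ∩ L^∞)` of
  Ożański–Pooley 2018, Cor. 6.16, for `m = 0`.

## 2. A singular point at the blow-up time

With `p = 3` the same continuity makes `u` a **Kato `C([0,T); L³)` mild solution**
(`isKatoSolutionOn_of_classical`), whose maximal time *as such* is `T` when `u` does not extend
smoothly (`not_isKatoSolutionOn_of_not_hasSmoothExtensionPast`: uniqueness `kato_unique_holds`,
smoothing `mild_L3_smooth_holds`, gluing — the argument of the tree's `seregin_L3_blowup_of_mild`).
Hence the tree's theorem `lemarieRieusset_singular_point_of_blowup_holds` (Lemarié-Rieusset 2016,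
Thm. 15.1 (C): far-field bound of Kato solutions + compactness of closed balls) applies:
**a classical Leray–Hopf solution from a rapidly decaying datum that blows up at `T` has a point
`x₀` with `u ∉ L^∞(Q_r(T, x₀))` for every `r > 0`**
(`exists_singularPoint_of_classical_of_not_hasSmoothExtensionPast`), i.e. regularity of every
`(T, x₀)` suffices for the continuation (`hasSmoothExtensionPast_of_forall_exists_parabolicCylinder`).
This is Cor. 4.6 of Albritton / Step 1 of Wang–Zhang's §4 for the solutions of the criterion,
obtained here without Calderón splitting (the solution has finite energy).

## 3. The criterion from the regularity of the points `(T, x₀)`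

Consequently the criterion follows from the *analytic core* of either blow-up proof alone, taken
as a hypothesis in the shape the tree uses:

* `…_of_katoClass_regular (hS)` — Albritton 2018, §3 Steps 1–3 over Albritton's class (a member
  with a frequently bounded critical norm at `T` has no singular point at time `T`; conclusion shape
  of `albritton_besov_blowup.regular_of_frequently_le_katoClass`), *without* Cor. 4.6 over that
  class;
* `…_of_classical_regular (hW)` — Wang–Zhang 2017, Thm. 1.2 with §4, for the classical solutions of
  the criterion (no `(T, x₀)` is singular under the `sup` bound), sharpening
  `…_of_besov_sup_bound` (`NSCriticalClosureBesovESS.lean`).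

## References

* D. Albritton, *Blow-up criteria for the Navier–Stokes equations in non-endpoint critical Besov
  spaces*, Anal. PDE 11 (2018) 1415–1456 = arXiv:1612.04439: Thm. 1.1 (p. 4); §3 Steps 1–3 with
  (3.2); Thm. 4.2 with (4.51)–(4.53) and the display defining `K̊^s_p(Q_T)` (pp. 20–21 of the arXiv
  version); Cor. 4.6 (p. 25). [Albritton2018]
* I. Gallagher, G. S. Koch, F. Planchon, Comm. Math. Phys. 343 (2016) 39–82 = arXiv:1407.4156,
  Thm. 1, (1.6). [GKP2016]
* W. Wang, Z. Zhang, *Blow-up of critical norms for the 3-D Navier–Stokes equations*, Sci. China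
  Math. 60 (2017) 637–650 = arXiv:1510.02589, Thm. 1.2, §4. [WangZhang2016]
* P. G. Lemarié-Rieusset, *The Navier–Stokes Problem in the 21st Century*, CRC Press 2016,
  Thm. 15.1 (A)–(C), Thm. 7.7, Prop. 6.5, Thm. 6.1. [LemarieRieusset2016]
* J. C. Robinson, J. L. Rodrigo, W. Sadowski, *The three-dimensional Navier–Stokes equations*
  (2016), Thm. 1.20 (Agmon's inequality). [RobinsonRodrigoSadowski2016]
* W. S. Ożański, B. C. Pooley, *Leray's fundamental work on the Navier–Stokes equations* (2018),
  Cor. 6.16. [OzanskiPooley2018]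
* T. Tao, *Localisation and compactness properties of the Navier–Stokes global regularity
  problem*, Anal. PDE 6 (2013), Cor. 11.1, Thm. 5.4. [Tao2011]
-/

noncomputable section

open MeasureTheory TemperedDistribution Set Function Filter
open _root_.Topology
open scoped SchwartzMap ENNReal NNReal RealInnerProductSpace Laplacian

namespace Literature.Analysis.FluidPDE

open FunctionSpaces (IsSmoothL2Field)

/-! ### Agmon interpolation for smooth `L²` fields on `ℝ³` -/

section Agmon

/-- **Green's identity as an inequality**: for a smooth `L²` field `w` on `ℝ³`,
`∫ |∇w|²_F = -∫ ⟪w, Δw⟫ ≤ ‖w‖_{L²} ‖Δw‖_{L²}` (the tree's `IsSmoothL2Field.integral_inner_laplacian`,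
`frobeniusNormSq_eq_sum` and Cauchy–Schwarz). [folklore] -/
theorem _root_.Literature.Analysis.FunctionSpaces.IsSmoothL2Field.integral_frobeniusNormSq_fderiv_le
    {w : EuclideanSpace ℝ (Fin 3) → EuclideanSpace ℝ (Fin 3)} (hw : IsSmoothL2Field w) :
    ∫ y, frobeniusNormSq (fderiv ℝ w y) ≤
      (eLpNorm w 2 volume).toReal * (eLpNorm (Δ w) 2 volume).toReal := by
  -- `∫ |∇w|²_F = ∑ᵢ ∫ ‖∂ᵢ w‖²`
  have hint : ∀ i, Integrable
      (fun y => ‖fderiv ℝ w y (stdOrthonormalBasis ℝ (EuclideanSpace ℝ (Fin 3)) i)‖ ^ 2) volume :=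
    fun i => (memLp_two_iff_integrable_sq_norm (hw.memLp_fderiv_apply _).1).1
      (hw.memLp_fderiv_apply _)
  have hG : ∫ y, frobeniusNormSq (fderiv ℝ w y) =
      ∑ i, ∫ y, ‖fderiv ℝ w y (stdOrthonormalBasis ℝ (EuclideanSpace ℝ (Fin 3)) i)‖ ^ 2 := by
    rw [← integral_finsetSum _ fun i _ => hint i]
    refine integral_congr_ae (Eventually.of_forall fun y => ?_)
    exact frobeniusNormSq_eq_sum (stdOrthonormalBasis ℝ (EuclideanSpace ℝ (Fin 3))) (fderiv ℝ w y)
  -- Green: `∫ ⟪w, Δw⟫ = -∑ᵢ ∫ ‖∂ᵢ w‖²`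
  have hGreen : ∫ y, inner ℝ (w y) ((Δ w) y) =
      -∑ i, ∫ y, ‖fderiv ℝ w y (stdOrthonormalBasis ℝ (EuclideanSpace ℝ (Fin 3)) i)‖ ^ 2 :=
    hw.integral_inner_laplacian
  -- Cauchy–Schwarz
  have hΔ : IsSmoothL2Field (Δ w) := hw.laplacian
  have hCS : ‖∫ y, inner ℝ (w y) ((Δ w) y)‖ ≤
      (eLpNorm w 2 volume).toReal * (eLpNorm (Δ w) 2 volume).toReal := by
    have h := FunctionSpaces.enorm_integral_inner_le_eLpNorm_mul
      (π := (volume : Measure (EuclideanSpace ℝ (Fin 3)))) hw.memLp_two.1 hΔ.memLp_two.1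
    rw [← ENNReal.toReal_mul, ← toReal_enorm]
    exact ENNReal.toReal_mono (ENNReal.mul_ne_top hw.memLp_two.eLpNorm_ne_top
      hΔ.memLp_two.eLpNorm_ne_top) h
  have hEq : ∫ y, frobeniusNormSq (fderiv ℝ w y) = -∫ y, inner ℝ (w y) ((Δ w) y) := by
    rw [hGreen, hG, neg_neg]
  rw [hEq]
  exact (neg_le_abs _).trans (le_of_eq_of_le (Real.norm_eq_abs _).symm hCS)

/-- **Agmon's inequality in interpolation form**: for a smooth `L²` field `w` on `ℝ³` and every `x`,
`‖w(x)‖ ≤ K_Ag (‖w‖_{L²} ‖Δw‖³_{L²})^{1/4}` — Agmon's `‖w‖_∞ ≤ K_Ag (∫|∇w|²_F ∫‖Δw‖²)^{1/4}`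
(Robinson–Rodrigo–Sadowski 2016, Thm. 1.20; the tree's `IsSmoothL2Field.norm_le_agmon_laplacian`)
with `∫|∇w|²_F ≤ ‖w‖_{L²}‖Δw‖_{L²}` (`integral_frobeniusNormSq_fderiv_le`) and `∫‖Δw‖² = ‖Δw‖²_{L²}`.
[cite: RobinsonRodrigoSadowski2016, Thm. 1.20] -/
theorem _root_.Literature.Analysis.FunctionSpaces.IsSmoothL2Field.norm_le_agmon_interpolate
    {w : EuclideanSpace ℝ (Fin 3) → EuclideanSpace ℝ (Fin 3)} (hw : IsSmoothL2Field w)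
    (x : EuclideanSpace ℝ (Fin 3)) :
    ‖w x‖ ≤ agmonConst *
      ((eLpNorm w 2 volume).toReal * (eLpNorm (Δ w) 2 volume).toReal ^ 3) ^ (1 / 4 : ℝ) := by
  set N := (eLpNorm w 2 volume).toReal with hN
  set A := (eLpNorm (Δ w) 2 volume).toReal with hA
  -- `∫ ‖Δw‖² = A²`
  have hΔ2 : MemLp (Δ w) 2 volume := hw.laplacian.memLp_two
  have hD : ∫ y, ‖(Δ w) y‖ ^ 2 = A ^ 2 := by
    have hint : Integrable (fun y => ‖(Δ w) y‖ ^ 2) volume :=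
      (memLp_two_iff_integrable_sq_norm hΔ2.1).1 hΔ2
    have h1 : ENNReal.ofReal (∫ y, ‖(Δ w) y‖ ^ 2) = eLpNorm (Δ w) 2 volume ^ 2 := by
      rw [ofReal_integral_sq_norm hint, FunctionSpaces.eLpNorm_two_sq_eq_lintegral]
    have h2 := congrArg ENNReal.toReal h1
    rwa [ENNReal.toReal_ofReal (integral_nonneg fun _ => sq_nonneg _), ENNReal.toReal_pow] at h2
  have hG := hw.integral_frobeniusNormSq_fderiv_le
  have hG0 : 0 ≤ ∫ y, frobeniusNormSq (fderiv ℝ w y) :=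
    integral_nonneg fun _ => frobeniusNormSq_nonneg _
  refine (hw.norm_le_agmon_laplacian x).trans (mul_le_mul_of_nonneg_left
    (Real.rpow_le_rpow (mul_nonneg hG0 (integral_nonneg fun _ => sq_nonneg _)) ?_ (by norm_num))
    agmonConst_nonneg)
  rw [hD]
  calc (∫ y, frobeniusNormSq (fderiv ℝ w y)) * A ^ 2 ≤ (N * A) * A ^ 2 :=
        mul_le_mul_of_nonneg_right hG (sq_nonneg _)
    _ = N * A ^ 3 := by ring

/-- **`‖Δ(f - g)‖_{L²} ≤ 3 (C^{1/2} + C^{1/2})`** for `C²` fields `f, g` on `ℝ³` with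
`∫⁻ ‖D²f‖ₑ², ∫⁻ ‖D²g‖ₑ² ≤ C` (`‖Δh‖ ≤ 3‖D²h‖` pointwise,
`norm_laplacian_le_three_mul_norm_iteratedFDeriv_two`, `D²(f - g) = D²f - D²g`, Minkowski).
[folklore] -/
theorem eLpNorm_laplacian_sub_two_le {F : Type*} [NormedAddCommGroup F] [InnerProductSpace ℝ F]
    {f g : EuclideanSpace ℝ (Fin 3) → F} (hf : ContDiff ℝ 2 f) (hg : ContDiff ℝ 2 g) {C : ℝ≥0∞}
    (hfC : ∫⁻ x, ‖iteratedFDeriv ℝ 2 f x‖ₑ ^ 2 ≤ C) (hgC : ∫⁻ x, ‖iteratedFDeriv ℝ 2 g x‖ₑ ^ 2 ≤ C) :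
    eLpNorm (Δ (f - g)) 2 volume ≤ 3 * (C ^ (1 / 2 : ℝ) + C ^ (1 / 2 : ℝ)) := by
  have hfg : ContDiff ℝ 2 (f - g) := hf.sub hg
  have hsub : iteratedFDeriv ℝ 2 (f - g) = iteratedFDeriv ℝ 2 f - iteratedFDeriv ℝ 2 g :=
    iteratedFDeriv_sub hf hg
  have hle : ∀ᵐ x ∂(volume : Measure (EuclideanSpace ℝ (Fin 3))),
      ‖(Δ (f - g)) x‖₊ ≤ (3 : ℝ≥0) * ‖(iteratedFDeriv ℝ 2 f - iteratedFDeriv ℝ 2 g) x‖₊ :=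
    Eventually.of_forall fun x => by
      have h := norm_laplacian_le_three_mul_norm_iteratedFDeriv_two hfg x
      rw [hsub] at h
      rw [← NNReal.coe_le_coe]
      push_cast [coe_nnnorm]
      exact h
  have hmf : AEStronglyMeasurable (iteratedFDeriv ℝ 2 f) (volume : Measure (EuclideanSpace ℝ (Fin 3))) :=
    (hf.continuous_iteratedFDeriv le_rfl).aestronglyMeasurable
  have hmg : AEStronglyMeasurable (iteratedFDeriv ℝ 2 g) (volume : Measure (EuclideanSpace ℝ (Fin 3))) :=
    (hg.continuous_iteratedFDeriv le_rfl).aestronglyMeasurable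
  calc eLpNorm (Δ (f - g)) 2 volume
      ≤ (3 : ℝ≥0) • eLpNorm (iteratedFDeriv ℝ 2 f - iteratedFDeriv ℝ 2 g) 2 volume :=
        eLpNorm_le_nnreal_smul_eLpNorm_of_ae_le_mul hle 2
    _ ≤ (3 : ℝ≥0) • (eLpNorm (iteratedFDeriv ℝ 2 f) 2 volume + eLpNorm (iteratedFDeriv ℝ 2 g) 2 volume) := by
        gcongr
        exact eLpNorm_sub_le hmf hmg one_le_two
    _ ≤ (3 : ℝ≥0) • (C ^ (1 / 2 : ℝ) + C ^ (1 / 2 : ℝ)) := by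
        gcongr
        · exact eLpNorm_two_le_rpow_of_lintegral_sq_le hfC
        · exact eLpNorm_two_le_rpow_of_lintegral_sq_le hgC
    _ = 3 * (C ^ (1 / 2 : ℝ) + C ^ (1 / 2 : ℝ)) := by
        rw [ENNReal.smul_def, smul_eq_mul]
        norm_cast

end Agmon

/-! ### Classical Leray–Hopf solutions are continuous into `L^∞` and `L^p` -/

section Continuity

variable {ν T : ℝ} {u : ℝ → EuclideanSpace ℝ (Fin 3) → EuclideanSpace ℝ (Fin 3)}
  {π : ℝ → EuclideanSpace ℝ (Fin 3) → ℝ}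

/-- **Classical Leray–Hopf solutions are continuous into `L^∞` on closed slabs** (Ożański–Pooley
2018, Cor. 6.16: `∇ᵐu ∈ C((0,T); L² ∩ L^∞)`, case `m = 0`; Albritton 2018, Thm. 4.2 (4.52):
`u ∈ C((0,T]; L^∞)`). For `ν > 0`, a classical solution of the unforced system on `ℝ³ × [0, T)`,
Leray–Hopf from its rapidly decaying datum, and `T₁ < T`: `u ∈ C([0, T₁]; L^∞)`. Proof: on the slab
all Sobolev norms of `u` are bounded (Tao 2013, Cor. 11.1, `tao2011_hasBoundedSobolevNormsOn_holds`),
so the slices are smooth `L²` fields and `‖Δ(u(t) - u(t₀))‖_{L²}` is bounded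
(`eLpNorm_laplacian_sub_two_le`); Agmon's interpolation
`‖w‖_∞ ≤ K_Ag ‖w‖^{1/4}_{L²} ‖Δw‖^{3/4}_{L²}` (`IsSmoothL2Field.norm_le_agmon_interpolate`) and the
`L²` continuity of `u` (`continuousInLpOn_two_of_tao_local`) give `‖u(t) - u(t₀)‖_∞ → 0`.
[cite: OzanskiPooley2018, Cor. 6.16] -/
theorem continuousInLpOn_top_slab_of_classical (hν : 0 < ν) (hT : 0 < T)
    (hsol : IsClassicalNSSolutionOn (Ico 0 T) ν 0 u π) (hLH : IsLerayHopfOn T ν 0 (u 0) u)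
    (h₀ : HasRapidSpatialDecay (u 0)) :
    ∀ T₁ ∈ Ioo 0 T, ContinuousInLpOn (Icc 0 T₁) ∞ u := by
  intro T₁ hT₁
  have h₁ : tao2011_hasBoundedSobolevNormsOn := tao2011_hasBoundedSobolevNormsOn_holds
  -- the closed slab `[0, T₁]`: classical, finite energy, all Sobolev norms bounded
  have hsol₁ : IsClassicalNSSolutionOn (Icc 0 T₁) ν 0 u π :=
    hsol.mono (Icc_subset_Ico_right hT₁.2) (uniqueDiffOn_Icc hT₁.1)
  have hEn : ∃ C : ℝ≥0∞, C < ⊤ ∧ ∀ t ∈ Icc 0 T₁, ∫⁻ x, ‖u t x‖ₑ ^ 2 ≤ C :=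
    ⟨ENNReal.ofReal (2 * VectorCalculus.kineticEnergy (u 0)), ENNReal.ofReal_lt_top, fun t ht =>
      hLH.lintegral_enorm_sq_le hν.le ⟨ht.1, ht.2.trans hT₁.2.le⟩⟩
  have hH : HasBoundedSobolevNormsOn (Icc 0 T₁) u :=
    (tao2011_hasBoundedSobolevNormsOn.closedSlab h₁ linfty_bound_of_hasBoundedSobolevNormsOn_holds
      ν T₁ hν hT₁.1 u π hsol₁ hEn h₀).1
  -- the slices are smooth `L²` fields
  have hsm : ∀ t ∈ Icc 0 T₁, IsSmoothL2Field (u t) := fun t ht =>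
    isSmoothL2Field_of_sobolev (hsol₁.contDiff_velocity ht) fun n => by
      obtain ⟨C, hC⟩ := hH n
      exact (hC t ht).trans_lt ENNReal.coe_lt_top
  -- `L²` continuity on the slab
  have hL2 : ContinuousInLpOn (Icc 0 T₁) 2 u :=
    continuousInLpOn_two_of_tao_local tao2011_smooth_local_existence_holds h₁ hν hT hsol hLH h₀ T₁ hT₁
  -- the uniform bound `A₀` on `‖Δ(u t - u t₀)‖_{L²}`
  obtain ⟨C₂, hC₂⟩ := hH 2
  set A₀E : ℝ≥0∞ := 3 * ((C₂ : ℝ≥0∞) ^ (1 / 2 : ℝ) + (C₂ : ℝ≥0∞) ^ (1 / 2 : ℝ)) with hA₀E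
  have hA₀E_top : A₀E ≠ ⊤ := by
    refine ENNReal.mul_ne_top (by norm_num) (ENNReal.add_ne_top.2 ⟨?_, ?_⟩) <;>
      exact ENNReal.rpow_ne_top_of_nonneg (by norm_num) ENNReal.coe_ne_top
  set A₀ : ℝ := A₀E.toReal with hA₀
  have hΔ : ∀ t ∈ Icc 0 T₁, ∀ t₀ ∈ Icc 0 T₁, (eLpNorm (Δ (u t - u t₀)) 2 volume).toReal ≤ A₀ := by
    intro t ht t₀ ht₀
    exact ENNReal.toReal_mono hA₀E_top (eLpNorm_laplacian_sub_two_le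
      ((hsol₁.contDiff_velocity ht).of_le (by norm_cast))
      ((hsol₁.contDiff_velocity ht₀).of_le (by norm_cast)) (hC₂ t ht) (hC₂ t₀ ht₀))
  -- the modulus: `‖u t x - u t₀ x‖ ≤ K_Ag (‖u t - u t₀‖_{L²} A₀³)^{1/4}`
  have hmod : ∀ t ∈ Icc 0 T₁, ∀ t₀ ∈ Icc 0 T₁, ∀ x, ‖(u t - u t₀) x‖ ≤
      agmonConst * ((eLpNorm (u t - u t₀) 2 volume).toReal * A₀ ^ 3) ^ (1 / 4 : ℝ) := by
    intro t ht t₀ ht₀ x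
    have hw : IsSmoothL2Field (u t - u t₀) := (hsm t ht).sub (hsm t₀ ht₀)
    refine (hw.norm_le_agmon_interpolate x).trans
      (mul_le_mul_of_nonneg_left (Real.rpow_le_rpow ?_ ?_ (by norm_num)) agmonConst_nonneg)
    · exact mul_nonneg ENNReal.toReal_nonneg (pow_nonneg ENNReal.toReal_nonneg 3)
    · exact mul_le_mul_of_nonneg_left
        (pow_le_pow_left₀ ENNReal.toReal_nonneg (hΔ t ht t₀ ht₀) 3) ENNReal.toReal_nonneg
  refine ⟨fun t ht => ?_, fun t₀ ht₀ => ?_⟩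
  · -- the slices are in `L^∞`
    obtain ⟨M, hM⟩ := (hsm t ht).bounded 0
    refine memLp_top_of_bound (hsm t ht).continuous.aestronglyMeasurable M
      (Eventually.of_forall fun x => ?_)
    have h := hM x
    rwa [norm_iteratedFDeriv_zero] at h
  · -- continuity at `t₀` within the slab
    have hB : Tendsto (fun t => ENNReal.ofReal
        (agmonConst * ((eLpNorm (u t - u t₀) 2 volume).toReal * A₀ ^ 3) ^ (1 / 4 : ℝ)))
        (𝓝[Icc 0 T₁] t₀) (𝓝 0) := by
      have h3 : Tendsto (fun t => (eLpNorm (u t - u t₀) 2 volume).toReal) (𝓝[Icc 0 T₁] t₀)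
          (𝓝 0) := by
        have h := (ENNReal.tendsto_toReal ENNReal.zero_ne_top).comp (hL2.2 t₀ ht₀)
        rwa [ENNReal.toReal_zero] at h
      have h4 : Tendsto (fun t => ((eLpNorm (u t - u t₀) 2 volume).toReal * A₀ ^ 3) ^ (1 / 4 : ℝ))
          (𝓝[Icc 0 T₁] t₀) (𝓝 0) := by
        have h := (h3.mul_const (A₀ ^ 3)).rpow_const (p := (1 / 4 : ℝ)) (Or.inr (by norm_num))
        rwa [zero_mul, Real.zero_rpow (by norm_num)] at h
      have h5 := ENNReal.tendsto_ofReal (h4.const_mul agmonConst)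
      rwa [mul_zero, ENNReal.ofReal_zero] at h5
    refine tendsto_of_tendsto_of_tendsto_of_le_of_le' tendsto_const_nhds hB
      (Eventually.of_forall fun _ => bot_le) ?_
    filter_upwards [self_mem_nhdsWithin] with t ht
    rw [eLpNorm_exponent_top]
    exact eLpNormEssSup_le_of_ae_bound (Eventually.of_forall fun x => hmod t ht t₀ ht₀ x)

/-- **Classical Leray–Hopf solutions are continuous into `L^p`, `2 ≤ p < ∞`, on closed slabs**
(Albritton 2018, Thm. 4.2 (4.52): `u ∈ C((0,T]; L^p)`; Ożański–Pooley 2018, Cor. 6.16). For `ν > 0`,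
a classical solution on `ℝ³ × [0, T)`, Leray–Hopf from its rapidly decaying datum, and `T₁ < T`:
`u ∈ C([0, T₁]; L^p)` — the interpolation `‖w‖_{L^p} ≤ ((2M)^{p-2} ‖w‖²_{L²})^{1/p}`
(`eLpNorm_le_of_norm_le_of_lintegral_sq_le`) for `w = u(t) - u(t₀)`, `|u| ≤ M` on the slab
(`exists_forall_norm_le_of_tao2011`), and the `L²` continuity of `u`
(`continuousInLpOn_two_of_tao_local`). [cite: Albritton2018, Thm. 4.2 (4.52)] -/
theorem continuousInLpOn_slab_of_classical (hν : 0 < ν) (hT : 0 < T)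
    (hsol : IsClassicalNSSolutionOn (Ico 0 T) ν 0 u π) (hLH : IsLerayHopfOn T ν 0 (u 0) u)
    (h₀ : HasRapidSpatialDecay (u 0)) {p : ℝ≥0∞} (hp₂ : 2 ≤ p) (hp : p < ∞) :
    ∀ T₁ ∈ Ioo 0 T, ContinuousInLpOn (Icc 0 T₁) p u := by
  intro T₁ hT₁
  have h₁ : tao2011_hasBoundedSobolevNormsOn := tao2011_hasBoundedSobolevNormsOn_holds
  obtain ⟨M, hM⟩ := exists_forall_norm_le_of_tao2011 h₁ hν hsol hLH h₀ T₁ hT₁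
  have hL2 : ContinuousInLpOn (Icc 0 T₁) 2 u :=
    continuousInLpOn_two_of_tao_local tao2011_smooth_local_existence_holds h₁ hν hT hsol hLH h₀ T₁ hT₁
  obtain ⟨K, hK, hKb⟩ := exists_eLpNorm_slice_le_of_classical hν hsol hLH h₀ hp₂ hp T₁ hT₁
  have hcont : ∀ t ∈ Icc 0 T₁, Continuous (u t) := fun t ht =>
    (hsol.contDiff_velocity ⟨ht.1, ht.2.trans_lt hT₁.2⟩).continuous
  have hp2 : 2 ≤ p.toReal := by
    have h := ENNReal.toReal_mono hp.ne hp₂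
    rwa [ENNReal.toReal_ofNat] at h
  have hp0 : 0 < 1 / p.toReal := by positivity
  refine ⟨fun t ht => ⟨(hcont t ht).aestronglyMeasurable, (hKb t ht).trans_lt hK⟩, fun t₀ ht₀ => ?_⟩
  -- the interpolation bound
  have hbd : ∀ t ∈ Icc 0 T₁, eLpNorm (u t - u t₀) p volume ≤
      (ENNReal.ofReal (M + M) ^ (p.toReal - 2) * eLpNorm (u t - u t₀) 2 volume ^ 2) ^
        (1 / p.toReal) := by
    intro t ht
    refine eLpNorm_le_of_norm_le_of_lintegral_sq_le (fun x => ?_) ?_ hp₂ hp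
    · exact (norm_sub_le _ _).trans (add_le_add (hM t ht x) (hM t₀ ht₀ x))
    · rw [FunctionSpaces.eLpNorm_two_sq_eq_lintegral]
  -- its right-hand side tends to `0`
  have hlim : Tendsto (fun t => (ENNReal.ofReal (M + M) ^ (p.toReal - 2) *
      eLpNorm (u t - u t₀) 2 volume ^ 2) ^ (1 / p.toReal)) (𝓝[Icc 0 T₁] t₀) (𝓝 0) := by
    have h2 := hL2.2 t₀ ht₀
    have h3 : Tendsto (fun t => eLpNorm (u t - u t₀) 2 volume ^ 2) (𝓝[Icc 0 T₁] t₀) (𝓝 0) := by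
      have h := ((ENNReal.continuous_pow 2).tendsto 0).comp h2
      rwa [zero_pow two_ne_zero] at h
    have h4 : Tendsto (fun t => ENNReal.ofReal (M + M) ^ (p.toReal - 2) *
        eLpNorm (u t - u t₀) 2 volume ^ 2) (𝓝[Icc 0 T₁] t₀) (𝓝 0) := by
      have h := ENNReal.Tendsto.const_mul (a := ENNReal.ofReal (M + M) ^ (p.toReal - 2)) h3
        (Or.inr (ENNReal.rpow_ne_top_of_nonneg (by linarith) ENNReal.ofReal_ne_top))
      rwa [mul_zero] at h
    have h5 := ((ENNReal.continuous_rpow_const (y := 1 / p.toReal)).tendsto 0).comp h4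
    rwa [ENNReal.zero_rpow_of_pos hp0] at h5
  refine tendsto_of_tendsto_of_tendsto_of_le_of_le' tendsto_const_nhds hlim
    (Eventually.of_forall fun _ => bot_le) ?_
  filter_upwards [self_mem_nhdsWithin] with t ht using hbd t ht

/-- From continuity on every closed slab `[0, T₁]`, `0 < T₁ < T`, to continuity on any time set
`S ⊆ [0, T)` (each `t₀ ∈ S` is interior, from the right, to some slab). [folklore] -/
theorem continuousInLpOn_of_forall_Icc {X : Type*} [MeasureSpace X] {F : Type*}
    [NormedAddCommGroup F] {T : ℝ} {S : Set ℝ} {p : ℝ≥0∞} {v : ℝ → X → F} (hS : S ⊆ Ico 0 T)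
    (h : ∀ T₁ ∈ Ioo 0 T, ContinuousInLpOn (Icc 0 T₁) p v) : ContinuousInLpOn S p v := by
  have hmid : ∀ t ∈ S, (t + T) / 2 ∈ Ioo 0 T ∧ t < (t + T) / 2 := fun t ht =>
    ⟨⟨by linarith [(hS ht).1, (hS ht).2], by linarith [(hS ht).2]⟩, by linarith [(hS ht).2]⟩
  refine ⟨fun t ht => (h _ (hmid t ht).1).1 t ⟨(hS ht).1, (hmid t ht).2.le⟩, fun t₀ ht₀ => ?_⟩
  obtain ⟨hT₁, hlt⟩ := hmid t₀ ht₀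
  have hc := (h _ hT₁).2 t₀ ⟨(hS ht₀).1, hlt.le⟩
  refine hc.mono_left ?_
  have hmem : Iio ((t₀ + T) / 2) ∈ 𝓝[S] t₀ := mem_nhdsWithin_of_mem_nhds (Iio_mem_nhds hlt)
  rw [← nhdsWithin_inter_of_mem hmem]
  exact nhdsWithin_mono _ fun t ht => ⟨(hS ht.2).1, (mem_Iio.1 ht.1).le⟩

end Continuity

/-! ### Classical Leray–Hopf solutions lie in Albritton's class -/

section KatoClass

variable {ν T : ℝ} {u : ℝ → EuclideanSpace ℝ (Fin 3) → EuclideanSpace ℝ (Fin 3)}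
  {π : ℝ → EuclideanSpace ℝ (Fin 3) → ℝ}
  {U : ℝ → 𝓢'(EuclideanSpace ℝ (Fin 3), EuclideanSpace ℂ (Fin 3))}

/-- **Classical Leray–Hopf solutions lie in Albritton's class (4.52)** (Albritton 2018, Thm. 4.2:
`NS(u₀) ∈ K̊_p ∩ K̊_∞ ∩ C((0,T]; L^p ∩ L^∞)` below the maximal time; here for the classical
Leray–Hopf solution from a rapidly decaying datum, which is `NS(u 0)` by weak–strong uniqueness).
For `ν > 0`, `0 < T`, a classical solution on `ℝ³ × [0, T)`, Leray–Hopf from its rapidly decaying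
datum, with slices represented by `U t`, and `3 < p < ∞`, `2 ≤ q`:
`IsKatoBesovMildSolutionOn p q T ν u U` — the tree's Besov mild class
(`isBesovMildSolutionOn_of_classical`), the `K̊_p` clause with weight `t^{(1-3/p)/2}`, positive for
`p > 3` (`katoWeight_of_classical`), and `u ∈ C((0,T); L^p) ∩ C((0,T); L^∞)`
(`continuousInLpOn_slab_of_classical`, `continuousInLpOn_top_slab_of_classical`).
[cite: Albritton2018, Thm. 4.2 (4.52)] -/
theorem isKatoBesovMildSolutionOn_of_classical (hν : 0 < ν) (hT : 0 < T)
    (hsol : IsClassicalNSSolutionOn (Ico 0 T) ν 0 u π) (hLH : IsLerayHopfOn T ν 0 (u 0) u)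
    (h₀ : HasRapidSpatialDecay (u 0)) (hU : ∀ t ∈ Ico 0 T, IsDistributionOf (u t) (U t))
    {p q : ℝ≥0∞} [Fact (1 ≤ p)] (hp₃ : 3 < p) (hp : p < ∞) (hq₂ : 2 ≤ q) :
    IsKatoBesovMildSolutionOn p q T ν u U := by
  have hp₂ : 2 ≤ p := le_trans (by norm_num) hp₃.le
  have hα : 0 < (1 - 3 / p.toReal) / 2 := by
    have h3 : (3 : ℝ) < p.toReal := by
      have h := (ENNReal.toReal_lt_toReal (by norm_num : (3 : ℝ≥0∞) ≠ ⊤) hp.ne).2 hp₃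
      rwa [ENNReal.toReal_ofNat] at h
    have h1 : 3 / p.toReal < 1 := (div_lt_one (by linarith)).2 h3
    linarith
  exact
    { isBesovMildSolutionOn :=
        isBesovMildSolutionOn_of_classical tao2011_hasBoundedSobolevNormsOn_holds
          tao2011_isMildNSSolutionOn_of_memSobolevX_holds tao2011_smooth_local_existence_holds
          tendsto_lowFreqCutoff_of_memLp_two_holds eHomBesovNorm_le_of_sobolev_one_holds hν hT hsol
          hLH h₀ hU hp₂ hp hq₂
      memKatoWeightClassOn := katoWeight_of_classical hν hT hsol hLH h₀ hp₂ hp hα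
      continuousInLpOn := continuousInLpOn_of_forall_Icc Ioo_subset_Ico_self
        (continuousInLpOn_slab_of_classical hν hT hsol hLH h₀ hp₂ hp)
      continuousInLpOn_top := continuousInLpOn_of_forall_Icc Ioo_subset_Ico_self
        (continuousInLpOn_top_slab_of_classical hν hT hsol hLH h₀) }

/-- **A classical Leray–Hopf solution that does not extend past `T` is maximal in Albritton's
class** (Albritton 2018, Thm. 4.2, the maximal time of existence: "for all `T > T*(u₀)`, the
solution `u` cannot be extended"). If `u` as above does not extend smoothly past `T`, then no member
`(v, V)` of Albritton's class on a longer interval `[0, T')` agrees with `u` a.e. at every time of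
`[0, T)`: such a `v` is a Besov mild solution of the tree's class, essentially bounded near `T` by its
`K̊_∞` clause, whence `u` is bounded near `T` and extends by the KNSS smoothing of bounded mild
solutions (`hasSmoothExtensionPast_of_isBesovMildSolutionOn_extension_of_bounded` with
`knss2009_local_smoothing_holds`). Exponents `3 < p < ∞`, `2 ≤ q < ∞`. [cite: Albritton2018, Thm. 4.2] -/
theorem isMaximalKatoBesovMildSolution_of_classical_of_not_hasSmoothExtensionPast (hν : 0 < ν)
    (hT : 0 < T) (hsol : IsClassicalNSSolutionOn (Ico 0 T) ν 0 u π)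
    (hLH : IsLerayHopfOn T ν 0 (u 0) u) (h₀ : HasRapidSpatialDecay (u 0))
    (hU : ∀ t ∈ Ico 0 T, IsDistributionOf (u t) (U t)) {p q : ℝ≥0∞} [Fact (1 ≤ p)] (hp₃ : 3 < p)
    (hp : p < ∞) (hq₂ : 2 ≤ q) (hq : q < ∞) (hext : ¬ HasSmoothExtensionPast ν 0 u T) :
    IsMaximalKatoBesovMildSolution p q T ν u U := by
  refine ⟨isKatoBesovMildSolutionOn_of_classical hν hT hsol hLH h₀ hU hp₃ hp hq₂, ?_⟩
  rintro ⟨T', hT', v, V, hv, hvu⟩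
  have hK : knss_classical_of_bounded_isBesovMildSolutionOn :=
    knss_classical_of_bounded_isBesovMildSolutionOn_of_local
      (knss2009_local_smoothing_holds (EuclideanSpace ℝ (Fin 3)))
  have hbdd := exists_forall_norm_le_of_tao2011 tao2011_hasBoundedSobolevNormsOn_holds hν hsol hLH h₀
  exact hext (hasSmoothExtensionPast_of_isBesovMildSolutionOn_extension_of_bounded hK hν hT hT' hsol
    hbdd hp₃ hp (le_trans (by norm_num) hq₂) hq hv.isBesovMildSolutionOn hvu)

end KatoClass

/-! ### A classical Leray–Hopf solution that blows up at `T` has a singular point `(T, x₀)` -/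

section KatoL3

variable {ν T : ℝ} {u : ℝ → EuclideanSpace ℝ (Fin 3) → EuclideanSpace ℝ (Fin 3)}
  {π : ℝ → EuclideanSpace ℝ (Fin 3) → ℝ}

/-- **Classical Leray–Hopf solutions are Kato `C_t L³` solutions** (Lemarié-Rieusset 2016,
Thm. 15.1 (A)–(B) with Prop. 6.5 / Thm. 6.1 and Fabes–Jones–Rivière 1972, Thm. 2.1: the Leray–Hopf
solution from `u₀ ∈ L² ∩ L³` is the mild solution `NS(u₀) ∈ C([0,T); L³)`; here for the classical
Leray–Hopf solution from a rapidly decaying datum, as in the tree's `seregin_L3_blowup_of_mild`).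
For `ν > 0`, `0 < T`, a classical solution on `ℝ³ × [0, T)`, Leray–Hopf from its rapidly decaying
datum: `IsKatoSolutionOn T ν (u 0) u` — mild on `[0, T)` (`isMildNSSolutionOn_of_isLerayHopfOn_holds`
on `(0, T]`, the weak initial condition at `t = 0`), `u ∈ C([0,T); L³)`
(`continuousInLpOn_slab_of_classical` with `p = 3`), `u 0 = u 0`, jointly continuous hence
measurable on the strip. [cite: LemarieRieusset2016, Thm. 15.1 (A)-(B), Prop. 6.5 and Thm. 6.1] -/
theorem isKatoSolutionOn_of_classical (hν : 0 < ν) (hT : 0 < T)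
    (hsol : IsClassicalNSSolutionOn (Ico 0 T) ν 0 u π) (hLH : IsLerayHopfOn T ν 0 (u 0) u)
    (h₀ : HasRapidSpatialDecay (u 0)) : IsKatoSolutionOn T ν (u 0) u := by
  have hdiv0 : IsWeaklyDivFree (u 0) := hLH.isWeaklyDivFree_datum hT
  have hu02 : MemLp (u 0) 2 volume := hLH.memLp 0 ⟨le_rfl, hT.le⟩
  -- mild on `[0, T)`: Leray–Hopf ⇒ mild on `(0, T]`; at `t = 0` the duality identity is the weak
  -- initial condition, trivial for the datum `u 0`
  have hmildT : IsMildNSSolutionOn (Ioc 0 T) ν 0 (u 0) u :=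
    isMildNSSolutionOn_of_isLerayHopfOn_holds hν hT hu02 hLH
  have hmild : IsMildNSSolutionOn (Ico 0 T) ν 0 (u 0) u := by
    refine ⟨fun t ht => ?_, fun t ht => ?_⟩
    · rcases ht.1.eq_or_lt with h0 | hpos
      · rw [← h0]; exact hdiv0
      · exact hmildT.1 t ⟨hpos, ht.2.le⟩
    · rcases ht.1.eq_or_lt with h0 | hpos
      · rw [← h0]; exact isMildNSSolutionFrom_zero_iff.2 fun φ _ _ => rfl
      · exact hmildT.2 t ⟨hpos, ht.2.le⟩
  -- `u ∈ C([0, T); L³)`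
  have hC3 : ContinuousInLpOn (Ico 0 T) 3 u :=
    continuousInLpOn_of_forall_Icc Subset.rfl
      (continuousInLpOn_slab_of_classical hν hT hsol hLH h₀ (by norm_num) ENNReal.ofNat_lt_top)
  -- measurability on `(0, T) × ℝ³` (joint continuity)
  have hcont : ContinuousOn (uncurry u) (Ico 0 T ×ˢ univ) := hsol.smooth_velocity.continuousOn
  have hmeas : AEStronglyMeasurable (uncurry u) (volume.restrict (Ioo 0 T ×ˢ univ)) :=
    (hcont.mono (prod_mono Ioo_subset_Ico_self Subset.rfl)).aestronglyMeasurable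
      (measurableSet_Ioo.prod MeasurableSet.univ)
  exact ⟨hmild, hC3, rfl, hmeas⟩

/-- **A classical Leray–Hopf solution that does not extend past `T` has maximal time `T` as a
Kato `C_t L³` solution** (the tree's argument of `seregin_L3_blowup_of_mild`; Lemarié-Rieusset
2016, Thm. 15.1 (A) and Thm. 7.7): a Kato solution `v` from `u 0` on a longer `[0, T')` agrees with
`u` a.e. at every time of `[0, T)` (`kato_unique_holds`, Furioli–Lemarié-Rieusset–Terraneo), is
represented on `(0, T')` by a classical solution `(w, ϖ)` (`mild_L3_smooth_holds`, Giga 1986 /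
Thm. 15.1 (A)), `u = w` on `(0, T) × ℝ³` by continuity, and `u` glued to `w` at `T` is a
classical continuation of `u` past `T` (`IsClassicalNSSolutionOn.glue`).
[cite: LemarieRieusset2016, Thm. 15.1 (A) and Thm. 7.7] -/
theorem not_isKatoSolutionOn_of_not_hasSmoothExtensionPast (hν : 0 < ν) (hT : 0 < T)
    (hsol : IsClassicalNSSolutionOn (Ico 0 T) ν 0 u π) (hLH : IsLerayHopfOn T ν 0 (u 0) u)
    (h₀ : HasRapidSpatialDecay (u 0)) (hext : ¬ HasSmoothExtensionPast ν 0 u T) :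
    ∀ T' : ℝ, T < T' → ∀ v : ℝ → EuclideanSpace ℝ (Fin 3) → EuclideanSpace ℝ (Fin 3),
      ¬ IsKatoSolutionOn T' ν (u 0) v := by
  intro T' hTT' v hv
  have hK := isKatoSolutionOn_of_classical hν hT hsol hLH h₀
  have hT'pos : 0 < T' := hT.trans hTT'
  have h₃ : MemLp (u 0) 3 volume := hK.continuousInLpOn.1 0 ⟨le_rfl, hT⟩
  have hdiv0 : IsWeaklyDivFree (u 0) := hLH.isWeaklyDivFree_datum hT
  obtain ⟨hvm, hvc, -, hvmeas⟩ := hv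
  -- uniqueness on `[0, T)`
  have hvmeas' : AEStronglyMeasurable (uncurry v) (volume.restrict (Ioo 0 T ×ˢ univ)) :=
    hvmeas.mono_measure (Measure.restrict_mono (prod_mono (Ioo_subset_Ioo_right hTT'.le)
      Subset.rfl) le_rfl)
  have hae : ∀ t ∈ Ico 0 T, u t =ᵐ[volume] v t :=
    kato_unique_holds hν h₃ hK.mild (hvm.mono (Ico_subset_Ico_right hTT'.le)) hK.continuousInLpOn
      (hvc.mono (Ico_subset_Ico_right hTT'.le)) hK.2.2.2 hvmeas'
  -- smoothness of `v` on `(0, T')`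
  obtain ⟨w, ϖ, hw, hwv⟩ := mild_L3_smooth_holds hν hT'pos h₃ hdiv0 hvm hvc hvmeas
  -- `u = w` on `(0, T) × ℝ³`
  have heq : ∀ t ∈ Ioo 0 T, u t = w t := by
    intro t ht
    have h1 : u t =ᵐ[volume] w t :=
      (hae t ⟨ht.1.le, ht.2⟩).trans (hwv t ⟨ht.1, ht.2.trans hTT'⟩).symm
    exact (Continuous.ae_eq_iff_eq volume (hsol.contDiff_velocity ⟨ht.1.le, ht.2⟩).continuous
      (hw.contDiff_velocity ⟨ht.1, ht.2.trans hTT'⟩).continuous).1 h1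
  -- glue to a classical continuation past `T`
  have hglue := hsol.glue hw le_rfl hT hTT'.le heq
  exact hext ⟨T', hTT', _, _, hglue, fun t ht => if_pos ht.2⟩

/-- **A classical Leray–Hopf solution that blows up at `T` has a singular point `(T, x₀)`**
(Lemarié-Rieusset 2016, Thm. 15.1 (C), PDF pp. 565–566: a finite maximal time of the Kato solution
carries a point `x₀` with `u ∉ L^∞(Q_r(T, x₀))` for every `r > 0` — the tree's theorem
`lemarieRieusset_singular_point_of_blowup_holds`, from the far-field bound of Kato solutions and
the compactness of closed balls; Albritton 2018, Cor. 4.6 / Rusin–Šverák 2011, §4 for the same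
statement). For `ν > 0`, `0 < T`, a classical solution on `ℝ³ × [0, T)`, Leray–Hopf from its
rapidly decaying datum, which does not extend smoothly past `T`: there is `x₀` with
`‖u‖_{L^∞(Q_r(T, x₀))} = ∞` for all `0 < r`, `r² < T` — since `u` is then a Kato `C_t L³` solution
with maximal time `T` (`isKatoSolutionOn_of_classical`,
`not_isKatoSolutionOn_of_not_hasSmoothExtensionPast`). [cite: LemarieRieusset2016, Thm. 15.1 (C)] -/
theorem exists_singularPoint_of_classical_of_not_hasSmoothExtensionPast (hν : 0 < ν) (hT : 0 < T)
    (hsol : IsClassicalNSSolutionOn (Ico 0 T) ν 0 u π) (hLH : IsLerayHopfOn T ν 0 (u 0) u)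
    (h₀ : HasRapidSpatialDecay (u 0)) (hext : ¬ HasSmoothExtensionPast ν 0 u T) :
    ∃ x₀ : EuclideanSpace ℝ (Fin 3), ∀ r : ℝ, 0 < r → r ^ 2 < T →
      eLpNorm (uncurry u) ∞ (volume.restrict (parabolicCylinder r ((T : ℝ), x₀))) = ∞ := by
  have hK := isKatoSolutionOn_of_classical hν hT hsol hLH h₀
  exact lemarieRieusset_singular_point_of_blowup_holds hν hT (hK.continuousInLpOn.1 0 ⟨le_rfl, hT⟩)
    (hLH.isWeaklyDivFree_datum hT) hK
    (not_isKatoSolutionOn_of_not_hasSmoothExtensionPast hν hT hsol hLH h₀ hext)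

/-- **No singular point at time `T` ⇒ the classical solution extends past `T`** (contrapositive
packaging of `exists_singularPoint_of_classical_of_not_hasSmoothExtensionPast`; the form in which
the blow-up arguments conclude — Wang–Zhang 2017, §4, Step 1: "assume that `(x₀, T)` is a singular
point"; Albritton 2018, §3, Step 1): if every `x₀` has a backward cylinder `Q_r(T, x₀)`, `r > 0`, on
which `u` is essentially bounded, then `u` extends smoothly past `T` (a singular point would make
`‖u‖_{L^∞(Q_r(T,x₀))} = ∞` for *every* `r > 0`, `eLpNorm_top_parabolicCylinder_eq_top_of_small`).
[cite: LemarieRieusset2016, Thm. 15.1 (C)] -/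
theorem hasSmoothExtensionPast_of_forall_exists_parabolicCylinder (hν : 0 < ν) (hT : 0 < T)
    (hsol : IsClassicalNSSolutionOn (Ico 0 T) ν 0 u π) (hLH : IsLerayHopfOn T ν 0 (u 0) u)
    (h₀ : HasRapidSpatialDecay (u 0))
    (hreg : ∀ x₀ : EuclideanSpace ℝ (Fin 3), ∃ r : ℝ, 0 < r ∧
      eLpNorm (uncurry u) ∞ (volume.restrict (parabolicCylinder r ((T : ℝ), x₀))) < ∞) :
    HasSmoothExtensionPast ν 0 u T := by
  by_contra hext
  obtain ⟨x₀, hx₀⟩ :=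
    exists_singularPoint_of_classical_of_not_hasSmoothExtensionPast hν hT hsol hLH h₀ hext
  obtain ⟨r, hr, hfin⟩ := hreg x₀
  exact hfin.ne (eLpNorm_top_parabolicCylinder_eq_top_of_small hT hx₀ hr)

end KatoL3

/-! ### The continuation criterion from a blow-up criterion over Albritton's class -/

/-- **The continuation criterion from the `sup` form of a blow-up criterion over Albritton's
class.** Hypothesis `h` (not asserted): for every viscosity `ν > 0`, all `3 < p, q < ∞`, `0 < T`,
every maximal member `(u, U)` of Albritton's class (4.52) with lifespan `T`
(`IsMaximalKatoBesovMildSolution p q T ν u U`, i.e. `NS(u₀)` with `T*(u₀) = T < ∞` by Thm. 4.2) has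
`sup_{0 ≤ t < T} ‖U t‖_{Ḃ^{s_p}_{p,q}} = ∞` — the weakest reading of GKP 2016, Thm. 1 /
Albritton 2018, Thm. 1.1 over that class. **Conclusion:** the continuation criterion. Proof: a
classical Leray–Hopf solution from a rapidly decaying datum with bounded critical norm that did not
extend would be such a maximal member
(`isMaximalKatoBesovMildSolution_of_classical_of_not_hasSmoothExtensionPast`), with bounded `sup`.
[cite: Albritton2018, Thm. 1.1 (with Thm. 4.2)] -/
theorem hasSmoothExtensionPast_of_eHomBesovNorm_bounded_of_katoClass_sup
    (h : ∀ ⦃ν : ℝ⦄, 0 < ν → ∀ ⦃p q : ℝ≥0∞⦄ [Fact (1 ≤ p)], 3 < p → p < ∞ → 3 < q → q < ∞ →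
      ∀ ⦃T : ℝ⦄, 0 < T → ∀ ⦃u : ℝ → EuclideanSpace ℝ (Fin 3) → EuclideanSpace ℝ (Fin 3)⦄
        ⦃U : ℝ → 𝓢'(EuclideanSpace ℝ (Fin 3), EuclideanSpace ℂ (Fin 3))⦄,
        IsMaximalKatoBesovMildSolution p q T ν u U →
          ⨆ t ∈ Ico 0 T, FunctionSpaces.eHomBesovNorm (-1 + 3 / p.toReal) p q (U t) = ∞) :
    hasSmoothExtensionPast_of_eHomBesovNorm_bounded := by
  intro ν T hν hT u π U r q _ hr₃ hr hq₃ hq hsol hLH h₀ hU hsup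
  by_contra hext
  have hmax := isMaximalKatoBesovMildSolution_of_classical_of_not_hasSmoothExtensionPast hν hT hsol
    hLH h₀ hU hr₃ hr (le_trans (by norm_num) hq₃.le) hq hext
  exact hsup.ne (h hν hr₃ hr hq₃ hq hT hmax)

/-- **The continuation criterion from the `limsup` form of a blow-up criterion over Albritton's
class** (GKP 2016, Thm. 1 as printed, "`limsup_{t → T*} ‖NS(u₀)(t)‖ = ∞`", read over Albritton's
class (4.52)); it implies the `sup` form since `limsup_{t ↑ T} ≤ sup_{[0,T)}`
(`limsup_nhdsLT_le_biSup_Ico`). [cite: GKP2016, Thm. 1] -/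
theorem hasSmoothExtensionPast_of_eHomBesovNorm_bounded_of_katoClass_limsup
    (h : ∀ ⦃ν : ℝ⦄, 0 < ν → ∀ ⦃p q : ℝ≥0∞⦄ [Fact (1 ≤ p)], 3 < p → p < ∞ → 3 < q → q < ∞ →
      ∀ ⦃T : ℝ⦄, 0 < T → ∀ ⦃u : ℝ → EuclideanSpace ℝ (Fin 3) → EuclideanSpace ℝ (Fin 3)⦄
        ⦃U : ℝ → 𝓢'(EuclideanSpace ℝ (Fin 3), EuclideanSpace ℂ (Fin 3))⦄,
        IsMaximalKatoBesovMildSolution p q T ν u U →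
          limsup (fun t => FunctionSpaces.eHomBesovNorm (-1 + 3 / p.toReal) p q (U t))
            (𝓝[<] T) = ∞) :
    hasSmoothExtensionPast_of_eHomBesovNorm_bounded := by
  refine hasSmoothExtensionPast_of_eHomBesovNorm_bounded_of_katoClass_sup
    fun ν hν p q _ hp₃ hp hq₃ hq T hT u U hmax => ?_
  have hle : limsup (fun t => FunctionSpaces.eHomBesovNorm (-1 + 3 / p.toReal) p q (U t))
      (𝓝[<] T) ≤ ⨆ t ∈ Ico 0 T, FunctionSpaces.eHomBesovNorm (-1 + 3 / p.toReal) p q (U t) :=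
    limsup_nhdsLT_le_biSup_Ico hT
  rw [h hν hp₃ hp hq₃ hq hT hmax, top_le_iff] at hle
  exact hle

/-- **The continuation criterion from Albritton's Theorem 1.1 in its faithful form.** Hypothesis
`hA` is, *verbatim*, the corrected named fact `albritton_besov_blowup_katoClass` displayed in
`AlbrittonBlowupCriterionKato.lean` (§"What this file does"): Albritton 2018, Thm. 1.1, for the mild
solution and maximal time of Thm. 4.2 (class (4.52)) — for every viscosity `ν > 0`, all
`3 < p, q < ∞` and `0 < T`, every maximal member `(u, U)` of Albritton's class with lifespan `T` has
`‖U t‖_{Ḃ^{s_p}_{p,q}} → ∞` as `t → T⁻`. It implies the `limsup` form along the non-trivial filter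
`𝓝[<] T` (`Tendsto.limsup_eq`), whence the criterion by
`hasSmoothExtensionPast_of_eHomBesovNorm_bounded_of_katoClass_limsup`. So
`hasSmoothExtensionPast_of_eHomBesovNorm_bounded_holds` is this theorem applied to
`albritton_besov_blowup_katoClass_holds` once that fact is declared and proved.
[cite: Albritton2018, Thm. 1.1 (with Thm. 4.2)] -/
theorem hasSmoothExtensionPast_of_eHomBesovNorm_bounded_of_albritton_besov_blowup_katoClass
    (hA : ∀ {ν : ℝ} (_hν : 0 < ν) {p q : ℝ≥0∞} [Fact (1 ≤ p)] (_hp₃ : 3 < p) (_hp : p < ∞)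
      (_hq₃ : 3 < q) (_hq : q < ∞) {T : ℝ} (_hT : 0 < T)
      {u : ℝ → EuclideanSpace ℝ (Fin 3) → EuclideanSpace ℝ (Fin 3)}
      {U : ℝ → 𝓢'(EuclideanSpace ℝ (Fin 3), EuclideanSpace ℂ (Fin 3))}
      (_hmax : IsMaximalKatoBesovMildSolution p q T ν u U),
      Tendsto (fun t => FunctionSpaces.eHomBesovNorm (-1 + 3 / p.toReal) p q (U t)) (𝓝[<] T)
        (𝓝 ∞)) :
    hasSmoothExtensionPast_of_eHomBesovNorm_bounded :=
  hasSmoothExtensionPast_of_eHomBesovNorm_bounded_of_katoClass_limsup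
    fun _ hν _ _ _ hp₃ hp hq₃ hq _ hT _ _ hmax => (hA hν hp₃ hp hq₃ hq hT hmax).limsup_eq

/-! ### The continuation criterion from the regularity of the points `(T, x₀)` -/

/-- **The continuation criterion from "§3, Steps 1–3" over Albritton's class.** Hypothesis `hS`
(not asserted; the analytic core of Albritton 2018, Thm. 1.1, §3 Steps 1–3 — rescaling about a
singular point, weak-`*` compactness in `Ḃ^{s_p}_{p,q}`, `q < ∞`, backward uniqueness — read over
Albritton's class (4.52), in the conclusion shape of the tree's
`albritton_besov_blowup.regular_of_frequently_le_katoClass`): a member `(u, U)` of Albritton's class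
on `[0, T)`, `0 < T`, `3 < p, q < ∞`, `ν > 0`, whose critical norm is bounded by some finite `M`
frequently as `t ↑ T` (Albritton's (3.2), `liminf < ∞`) is essentially bounded on some backward
cylinder `Q_r(T, x₀)`, `r > 0`, at every `x₀`. **Conclusion:** the continuation criterion — a
classical Leray–Hopf solution from a rapidly decaying datum with bounded critical norm lies in
Albritton's class (`isKatoBesovMildSolutionOn_of_classical`), its norm is bounded eventually (hence
frequently) as `t ↑ T`, so no `(T, x₀)` is singular and `u` extends
(`hasSmoothExtensionPast_of_forall_exists_parabolicCylinder`). Unlike the route through Thm. 1.1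
itself, this does not use Cor. 4.6 over Albritton's class. [cite: Albritton2018, Thm. 1.1, §3 Steps 1–3 with (3.2)] -/
theorem hasSmoothExtensionPast_of_eHomBesovNorm_bounded_of_katoClass_regular
    (hS : ∀ ⦃ν : ℝ⦄, 0 < ν → ∀ ⦃p q : ℝ≥0∞⦄ [Fact (1 ≤ p)], 3 < p → p < ∞ → 3 < q → q < ∞ →
      ∀ ⦃T : ℝ⦄, 0 < T → ∀ ⦃u : ℝ → EuclideanSpace ℝ (Fin 3) → EuclideanSpace ℝ (Fin 3)⦄
        ⦃U : ℝ → 𝓢'(EuclideanSpace ℝ (Fin 3), EuclideanSpace ℂ (Fin 3))⦄,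
        IsKatoBesovMildSolutionOn p q T ν u U →
        (∃ M : ℝ≥0, ∃ᶠ t in 𝓝[<] T,
          FunctionSpaces.eHomBesovNorm (-1 + 3 / p.toReal) p q (U t) ≤ M) →
        ∀ x₀ : EuclideanSpace ℝ (Fin 3), ∃ r : ℝ, 0 < r ∧
          eLpNorm (uncurry u) ∞ (volume.restrict (parabolicCylinder r ((T : ℝ), x₀))) < ∞) :
    hasSmoothExtensionPast_of_eHomBesovNorm_bounded := by
  intro ν T hν hT u π U r q _ hr₃ hr hq₃ hq hsol hLH h₀ hU hsup
  have hKB := isKatoBesovMildSolutionOn_of_classical hν hT hsol hLH h₀ hU hr₃ hr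
    (le_trans (by norm_num) hq₃.le)
  -- the bound by the (finite) supremum holds eventually, hence frequently, as `t ↑ T`
  have hfreq : ∃ M : ℝ≥0, ∃ᶠ t in 𝓝[<] T,
      FunctionSpaces.eHomBesovNorm (-1 + 3 / r.toReal) r q (U t) ≤ M := by
    refine ⟨(⨆ t ∈ Ico 0 T, FunctionSpaces.eHomBesovNorm (-1 + 3 / r.toReal) r q (U t)).toNNReal,
      Eventually.frequently ?_⟩
    filter_upwards [Ico_mem_nhdsLT hT] with t ht
    rw [ENNReal.coe_toNNReal hsup.ne]
    exact le_iSup₂ (f := fun t (_ : t ∈ Ico 0 T) =>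
      FunctionSpaces.eHomBesovNorm (-1 + 3 / r.toReal) r q (U t)) t ht
  exact hasSmoothExtensionPast_of_forall_exists_parabolicCylinder hν hT hsol hLH h₀
    (hS hν hr₃ hr hq₃ hq hT hKB hfreq)

/-- **The continuation criterion from the regularity of the points `(T, x₀)` of classical
solutions** — the Wang–Zhang form. Hypothesis `hW` (not asserted; the content of W. Wang,
Z. Zhang, Sci. China Math. 60 (2017), Thm. 1.2 with its proof, §4: for a smooth solution on
`ℝ³ × [0, T)` with `sup_t ‖u(t)‖_{Ḃ^{-1+3/p}_{p,q}} < ∞`, `3 < p, q < ∞`, the assumption "`(x₀, T)` is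
a singular point" leads to a contradiction by the uniform Morrey bounds of Lemma 4.1, rescaling,
compactness, the vanishing of the blow-up limit at the final time and backward uniqueness), stated
for the classical Leray–Hopf solutions from rapidly decaying data of the criterion: every `x₀` has
a backward cylinder `Q_ρ(T, x₀)`, `ρ > 0`, on which `u` is essentially bounded. **Conclusion:** the
continuation criterion (`hasSmoothExtensionPast_of_forall_exists_parabolicCylinder`: the far-field
bound and the compactness step that turn pointwise regularity at time `T` into a continuation are
theorems of the tree). This sharpens `hasSmoothExtensionPast_of_eHomBesovNorm_bounded_of_besov_sup_bound`
(`NSCriticalClosureBesovESS.lean`), which asked for boundedness on a whole strip `(T₁, T) × ℝ³`.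
[cite: WangZhang2016, Thm. 1.2 and §4] -/
theorem hasSmoothExtensionPast_of_eHomBesovNorm_bounded_of_classical_regular
    (hW : ∀ ⦃ν T : ℝ⦄, 0 < ν → 0 < T →
      ∀ ⦃u : ℝ → EuclideanSpace ℝ (Fin 3) → EuclideanSpace ℝ (Fin 3)⦄
        ⦃π : ℝ → EuclideanSpace ℝ (Fin 3) → ℝ⦄
        ⦃U : ℝ → 𝓢'(EuclideanSpace ℝ (Fin 3), EuclideanSpace ℂ (Fin 3))⦄ ⦃r q : ℝ≥0∞⦄
        [Fact (1 ≤ r)], 3 < r → r < ∞ → 3 < q → q < ∞ →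
        IsClassicalNSSolutionOn (Ico 0 T) ν 0 u π → IsLerayHopfOn T ν 0 (u 0) u →
        HasRapidSpatialDecay (u 0) → (∀ t ∈ Ico 0 T, IsDistributionOf (u t) (U t)) →
        (⨆ t ∈ Ico 0 T, FunctionSpaces.eHomBesovNorm (-1 + 3 / r.toReal) r q (U t)) < ⊤ →
        ∀ x₀ : EuclideanSpace ℝ (Fin 3), ∃ ρ : ℝ, 0 < ρ ∧
          eLpNorm (uncurry u) ∞ (volume.restrict (parabolicCylinder ρ ((T : ℝ), x₀))) < ∞) :
    hasSmoothExtensionPast_of_eHomBesovNorm_bounded := by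
  intro ν T hν hT u π U r q _ hr₃ hr hq₃ hq hsol hLH h₀ hU hsup
  exact hasSmoothExtensionPast_of_forall_exists_parabolicCylinder hν hT hsol hLH h₀
    (hW hν hT hr₃ hr hq₃ hq hsol hLH h₀ hU hsup)

end Literature.Analysis.FluidPDE

end
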